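import Mathlib
import HarnessLib
import Summits.HubbardSuperconductivity.HubbardSuperconductivity.Theorems.KLProgrammeKLRegimeSplitFieldStrengthFamilyTimeMoment
import Summits.HubbardSuperconductivity.HubbardSuperconductivity.Theorems.KLProgrammeKLRegimeSplitTwoLegMomentsFromFamily
import Summits.HubbardSuperconductivity.HubbardSuperconductivity.Theorems.KLProgrammeSectorisedLegKernelsDefs

/-!
# Route `KLProgramme` — ENGINE child gen 8 (stmt-HubbardSuperconductivity-20437), stub (e) residual B from a sectorised supplier: the two TOOLS that make
# `…SplitFieldStrengthFamilyTimeMoment` (p550818) and `…SplitTwoLegMomentsFromFamily` (p552003) turnkey for the programme's anisotropic family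
# (cell gate-hubbard-kl, seat hubbard-kl-r2d-p1 g7; KL STATUS 2026-08-27 (R59b): the (Y′) «(b)-HWT2» branch of the 08-29 word)

* §1 **COMPLETION OF A FAMILY**: `completeFamily F := Fin.snoc F (1 − Σ_ω F_ω)` — any `N`-member family plus its complement member is COMPLETE
  (`sum_completeFamily : ∀ k, Σ_ω completeFamily F ω k = 1`; `completeFamily_castSucc`, `completeFamily_last`), so p552003's
  `sectorisedKernel_trivialMultiplier_eq_sum_family` / `twoLeg_timeMoment_le_of_family` / `twoLeg_spaceMoment_le_of_family` apply to
  `completeFamily (klAnisoFamily …)`: a pair table over the scale-`n` sectors AND the complement member gives both rows of stub (e);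
* §2 **FREQUENCY SYMMETRY OF THE BGM MULTIPLIERS**: `bgmMultiplier_rev` / `klAnisoFamily_rev` — the multipliers read `k₀` only through `k₀²`
  (`matsubaraFreq_rev`), so `F_ω(ω₀.rev, k⃗) = F_ω(ω₀, k⃗)`; hence p550818's read-out needs ONE diagonal pair per shell point:
  **`abs_klFieldStrength_sub_one_le_of_klAnisoFamily_time_moment`** — for `k⃗` and labels `ω σ` with `F_{ω σ}(ω₀,k⃗) ≠ 0`, the circular time
  first moments `Mᵗ` of the `(ω σ, ω σ)`-sectorised two-leg kernels of `𝒱⁽ⁿ⁾[K] − 𝒩_K` give `|klFieldStrength … K n k⃗ − 1| ≤ Σ_σ Mᵗ/‖F_{ω σ}(ω₀,k⃗)‖²`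
  (row B1′ at every frame and scale from the scale-`n` family ALONE; row B2′ needs §1's complement pairs — the interpolant is global).

Proofs + one definition with body (`completeFamily`); nothing about the Hubbard model is asserted; nothing asserts superconductivity.
References: BGM 2006 §2.5 (2.45)–(2.48), §2.7 (2.70)–(2.71) [cite: BenfattoGiulianiMastropietro2006].
-/

noncomputable section

namespace Summit.HubbardSuperconductivity.HubbardSuperconductivity.Theorems.TwoLegFourier

set_option linter.dupNamespace false -- summit = problem name (single-conjunct summit), D-0017

open Finset Complex
open Literature.MathematicalPhysics.QuantumLattice Literature.Probability.LatticeModels GrassmannAlgebra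
open Summit.HubbardSuperconductivity.HubbardSuperconductivity.Theorems.KLRegimeSplit
open Summit.HubbardSuperconductivity.HubbardSuperconductivity.Theorems.KLProgrammeLegKernels

variable {L M : ℕ} {N : ℕ}

/-! ## §1 Completing a multiplier family by its complement member -/

/-- **`completeFamily F`** — the family `F` with ONE member appended: the complement `1 − Σ_ω F_ω` (last index). -/
def completeFamily (F : Fin N → FreqMomentum L M → ℂ) : Fin (N + 1) → FreqMomentum L M → ℂ :=
  Fin.snoc F (fun k => 1 - ∑ ω, F ω k)

/-- The old members are unchanged. -/
@[simp] theorem completeFamily_castSucc (F : Fin N → FreqMomentum L M → ℂ) (ω : Fin N) :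
    completeFamily F (Fin.castSucc ω) = F ω := by
  simp [completeFamily]

/-- The appended member is the complement. -/
@[simp] theorem completeFamily_last (F : Fin N → FreqMomentum L M → ℂ) :
    completeFamily F (Fin.last N) = fun k => 1 - ∑ ω, F ω k := by
  simp [completeFamily]

/-- **The completed family is complete**: `Σ_ω completeFamily F ω k = 1` at every `k`. -/
theorem sum_completeFamily (F : Fin N → FreqMomentum L M → ℂ) (k : FreqMomentum L M) : ∑ ω, completeFamily F ω k = 1 := by
  rw [Fin.sum_univ_castSucc]
  simp [completeFamily]

/-! ## §2 Frequency symmetry of the BGM multipliers and row B1′ from the scale-`n` family alone -/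

section BGM

/-- **The BGM multipliers read the frequency only through its square**: `F_ω(i.rev, k⃗) = F_ω(i, k⃗)` (`ω_{rev i} = −ω_i`). -/
theorem bgmMultiplier_rev (e₀ β : ℝ) (e : TorusSite 2 L → ℝ) (n : ℕ) (ω : Fin (sectorCount n)) (i : MatsubaraIdx M) (k : TorusSite 2 L) :
    bgmMultiplier L M e₀ β e n ω (i.rev, k) = bgmMultiplier L M e₀ β e n ω (i, k) := by
  simp only [bgmMultiplier, matsubaraFreq_rev, neg_sq]

/-- The programme's anisotropic family at any frame and scale is frequency-symmetric. -/
theorem klAnisoFamily_rev (β μ : ℝ) (K : TrigPolyC4v) (e₀ : ℝ) (n : ℕ) (ω : Fin (sectorCount n)) (i : MatsubaraIdx M) (k : TorusSite 2 L) :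
    klAnisoFamily L M β μ K e₀ n ω (i.rev, k) = klAnisoFamily L M β μ K e₀ n ω (i, k) := by
  unfold klAnisoFamily
  exact bgmMultiplier_rev e₀ β _ n ω i k

variable [NeZero L] [NeZero M]

/-- **ROW B1′ FROM THE SCALE-`m` ANISOTROPIC FAMILY ALONE** (any frame `K`, any scale `n` of the action, any sector scale `m` and cutoff unit `e₀` of the
family): for a torus momentum `k⃗` and, for each spin `σ`, ONE label `ω σ` whose multiplier does not vanish at `(ω₀, k⃗)`, the circular time first moments
`≤ Mᵗ` of the DIAGONAL `(ω σ, ω σ)`-sectorised two-leg kernels of `G' = 𝒱⁽ⁿ⁾[K] − 𝒩_K` give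
`|klFieldStrength … K n k⃗ − 1| ≤ Mᵗ/‖F_{ω 0}(ω₀,k⃗)‖² + Mᵗ/‖F_{ω 1}(ω₀,k⃗)‖²`. -/
theorem abs_klFieldStrength_sub_one_le_of_klAnisoFamily_time_moment {β : ℝ} (hβ : 0 < β) (U μ : ℝ) (K : TrigPolyC4v) (n : ℕ)
    (e₀ : ℝ) (m : ℕ) (k : TorusSite 2 L) (ω : Fin 2 → Fin (sectorCount m))
    (hω : ∀ σ, klAnisoFamily L M β μ K e₀ m (ω σ) (omega0 M, k) ≠ 0) {Mt : ℝ}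
    (hMt : ∀ (σ : Fin 2) (x₀ : SpaceTimeIdx L M), imagTimeWeight β M *
      ∑ x ∈ (univ : Finset (Fin 2 → SpaceTimeIdx L M)).filter (fun x => x 0 = x₀),
        imagTimeWeight β M * (circDist (2 * M) (x 0).1.val (x 1).1.val : ℝ) *
          ‖sectorisedKernel L M β (klAnisoFamily L M β μ K e₀ m) (klEffectiveAction L M β U μ K klE0 n - counterQuadratic L M β K) 2
            (![((ω σ, σ), 0), ((ω σ, σ), 1)] : Fin 2 → SectorLeg (sectorCount m)) x‖ ≤ Mt) :
    |klFieldStrength L M β U μ K n k - 1| ≤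
      Mt / ‖klAnisoFamily L M β μ K e₀ m (ω 0) (omega0 M, k) ^ 2‖ + Mt / ‖klAnisoFamily L M β μ K e₀ m (ω 1) (omega0 M, k) ^ 2‖ := by
  have hsq : ∀ σ, klAnisoFamily L M β μ K e₀ m (ω σ) (omega0 M, k) * klAnisoFamily L M β μ K e₀ m (ω σ) (omega0 M, k) =
      klAnisoFamily L M β μ K e₀ m (ω σ) (omega0 M, k) ^ 2 := fun σ => by ring
  have hrev : ∀ σ, klAnisoFamily L M β μ K e₀ m (ω σ) ((omega0 M).rev, k) * klAnisoFamily L M β μ K e₀ m (ω σ) ((omega0 M).rev, k) =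
      klAnisoFamily L M β μ K e₀ m (ω σ) (omega0 M, k) ^ 2 := fun σ => by rw [klAnisoFamily_rev]; ring
  exact abs_klFieldStrength_sub_one_le_of_family_time_moment_sub_counter hβ U μ K n (klAnisoFamily L M β μ K e₀ m) k ω ω
    (a := fun σ => klAnisoFamily L M β μ K e₀ m (ω σ) (omega0 M, k) ^ 2) (fun σ => pow_ne_zero 2 (hω σ)) hsq hrev hMt

end BGM

end Summit.HubbardSuperconductivity.HubbardSuperconductivity.Theorems.TwoLegFourier

end
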